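import Summits.QuantumFields.YangMills.Theorems.BalabanUVNodesN15NeumannCubeLiftImages
import Summits.QuantumFields.YangMills.Theorems.BalabanUVNodesN15NeumannCubeConvolutionDefect
import HarnessLib

/-!
# Route «BalabanUVNodes» (K3⁷), node N15 = NE2, -a lane, PROGRAMME P file P-IIh: THE η-DEFECT OF THE LIFTED CUBE PROPAGATOR BEHIND A BIG-TORUS OPERATOR THAT DOES NOT DESCEND —
# dag-n15-c WANT-n15-a (g12-3): N-IIk `hasMaj_idef_chiCube_comp_neumannCubeG_of` LIFTED to the torus family of record (cube side `L^s` FIXED, volume `M_ν = 2L^{m_T}` FREE; part 2 of 2)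

Cell `pub-ymgap`, seat `pub-ymgap-dag-n15-a` (KNIT-BY-NAME, g21; D-0062; chair R424 venue; `bears_on: R4∕N15`); `--kind proof --supports stmt-QuantumFields-20544 --as helper`.
Sequel of P-IIg `…NeumannCubeLiftImages` (§33 lifted images convolutions, §34 the uncut two-lattice lift `idef_liftCubeG` ∕ `hasMaj_pullVR_comp_restrict`) and N-IIk `…NeumannCubeConvolutionDefect`
(the doubled-torus row).  Answers dag-n15-c g12 I.31476 WANT-n15-a (g12-3): «N-IIk LIFTED for a NON-descending `T₁` (`[aQ*Q − ∂Π∂*, M_{h_k}]`: `h_k` is `M`-periodic, not `2L^{s+1}`-periodic) —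
the `hD3` of FILE 71 `hasMaj_idef_commOp_comp_of_add_cut` on the torus of record» (the doubled-torus instance takes N-IIk as is; P-IIf covers DESCENDING `T₁`).

WHAT.  Torus pair `π : Tor M → Tor M′`, `M′_ν = 2S ∣ M_ν`; cube `□ + c` of side `S`; coarse `n = L^k`, fine `n′ = L^r·n`; King's prolongation `P` on the BIG torus both sides, `P̃` on the cube
torus; `𝔇(A′, A) := A′∘P − P∘A`; `G^{↑}(□) = liftCubeG = π^* ∘ G(□′) ∘ ρ` (P-IIa).
§35 ★★ `idef_neumannCubeG` — the UNCUT η-defect of the cube propagator on its own torus, EXACTLY: `𝔇̃(G′(□′), G(□′)) = Sym′∘𝔇̃(G′,G)∘χ_□ + (Σ_T M_{mask_T}∘P̃∘R_T∘D)∘(G∘χ_□)` (N-IIb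
`G(□) = Sym∘G∘χ_□`, Leibniz, `𝔇(χ′_□, χ_□) = 0`, N-IIa `𝔇(Sym′, Sym)`); ★★ `idef_chiCube_comp_liftCubeG` — THE EXACT IDENTITY on the big torus:
  `𝔇(χ′_□T₁′G′^{↑}, χ_□T₁G^{↑}) = χ′_□ ∘ (T₁′ ∘ π′^* ∘ [Sym′∘𝔇̃(G′,G)∘χ_{□′} + (Σ_T mask∘P̃∘R_T∘D)∘(G∘χ_{□′})] ∘ ρ + 𝔇(T₁′,T₁) ∘ G^{↑})`
(Leibniz twice, `𝔇(χ′_□, χ_□) = 0` on the big torus, P-IIg `idef_liftCubeG`); ★★★ `hasMaj_idef_chiCube_comp_liftCubeG_of` — THE ROW, N-IIk's letters and constant VERBATIM: cube-torus inputs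
`G ≤ Ce^{−δ₀d′}` (`hG`), `𝔇̃(G′,G) ≤ C₀e^{−δ₀d′}` (`h0`), `∇_νG ≤ C₁e^{−δ₀d′}` (`h1`); BIG-torus inputs `T₁′ ≤ a₁e^{−ρ₁d}` (`hT′`), `𝔇(T₁′,T₁) ≤ r₁e^{−ρ₁d}` (`hDT`), row sum `c_r` at `σ`,
`ρ ≤ δ₀`, `ρ + σ ≤ ρ₁`; OUTPUT `𝔇(χ′_□T₁′G′^{↑}(□), χ_□T₁G^{↑}(□)) ≤ 1_□(y)1_□(y′)·2^{d+1}e^{δ₀}c_r·(a₁C₀ + a₁(d+1)C₁∕L^k + r₁C)·e^{−ρ|y−y′|_T}` — `T₁, T₁′` need NOT descend; NO letter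
of the coarse `T₁`.  Mechanism: each small-torus term is lifted UNCUT (P-IIg `hasMaj_pullVR_comp_restrict`), convolved ONCE with the big-torus operator (P-IIg `hasMaj_comp_of_liftImage(s)`:
the row sum eats the periodic repetitions) and cut (P-IIg `hasMaj_chiCube_comp_of_liftImage(s)`); the operators' defect runs behind P-IIe `hasMaj_liftCubeG_images`.
§36 ★★★ `hasMaj_idef_chiCube_comp_liftCubeG_family` — the same on the torus family of record `MP (paramsOf d L m_T k hL)` with cube torus `MP (paramsOf d L s k hL)`, `s ≤ m_T`, any corner,
cube-torus letters as HYPOTHESES (constant VERBATIM, UNIFORM in `m_T`); ★★★ `hasMaj_idef_chiCube_comp_liftCubeG_record` — programme N's constants plugged (part 39 `hasMaj_gOp` ∕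
`hasMaj_entries110`, part 52ff `hasMaj_twoGridDefect`): `∃ δ₀ C C₀ C₁ > 0`, letter `1_□1_□·2^{d+1}e^{δ₀}c_r·(a₁C₀(L^k)^{−γ∕2} + a₁(d+1)C₁∕L^k + r₁C)·e^{−ρd}` for EVERY `s ≤ m_T`, `k ≥ 1`, `r`, `c`.
HONEST FRAMING.  Block-majorant bookkeeping (Leibniz for `𝔇`, King's pairing through `ZMod.castHom`, method of images read through `π`, one mixed row-sum convolution per image) over LANDED
rows; no new analytic estimate; `U ≡ 1` torus MODEL of [B5] §1; [B6]'s printed road for `G(□)` is the random-walk expansion (2.91)–(2.93) on `T_□` — here only the kinematics of `T_□ → T` is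
used; nothing of [B6] (2.38)–(2.40) ∕ [B9] Thm 3.14 asserted; N15 NOT discharged (object-bound; NE2⁺ NOT PRINTED); counts UNMOVED (typed 28∕28 · discharged 5∕27); finite tori per index —
NOT continuum ∕ ℝ⁴ ∕ OS ∕ mass gap ∕ Clay.  Theorems only (0 def).
-/

noncomputable section

open scoped BigOperators Matrix
open Finset

namespace Summit.QuantumFields.YangMills.BalabanUVNodes.N15.TwoGrid

open Literature.MathematicalPhysics.QuantumFieldTheory.Balaban1983to89
open Literature.MathematicalPhysics.QuantumFieldTheory.Balaban1983to89.B5Prop11Plancherel (Tor fine unitVec)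
open Literature.MathematicalPhysics.QuantumFieldTheory.Balaban1983to89.B5SiteBridgeP12 (MP)
open Literature.MathematicalPhysics.QuantumFieldTheory.Balaban1983to89.B6Prop26Gluing (mulOp mulOp_apply ind ind_nonneg ind_le_one)
open Literature.MathematicalPhysics.QuantumFieldTheory.Balaban1983to89.B6Prop26ReachTransplant (restrictOp restrictOp_apply restrictOp_apply_of_injOn restrictOp_apply_of_not_mem)
open Literature.MathematicalPhysics.QuantumFieldTheory.King1986.Torus (blockOf tdistT tdistT_symm tdistT_nonneg)
open Literature.MathematicalPhysics.QuantumFieldTheory.Balaban1983to89.B11SectG (BlockNorm HasMaj RowSum hasMaj_comp)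
open Literature.MathematicalPhysics.QuantumFieldTheory.Balaban1983to89.B11AxialTransport190 (abs_le_loc_ofBlocks loc_ofBlocks_le)
open Literature.MathematicalPhysics.QuantumFieldTheory.Balaban1983to89.B6RandomWalk (Triangle254)
open Literature.MathematicalPhysics.QuantumFieldTheory.Balaban1983to89.B6UnitTorusCarrier (unitTorusGeo)
open Literature.MathematicalPhysics.QuantumFieldTheory.Balaban1983to89.T4EtaRateDefect (idef idef_comp)
open Literature.MathematicalPhysics.QuantumFieldTheory.Balaban1983to89.T4EtaRateCoeffDefect (pull pull_apply)
open Summit.QuantumFields.YangMills.BalabanUVNodes.N15.VectorPiece (kingPr kingPrV kingPrV_eq blkFine blkFine_comp_kingPrV)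

variable {d : ℕ}

/-! ## §35 The η-defect of the lifted cube propagator behind a big-torus operator: the exact identities and THE ROW -/

section Row

variable {L : ℕ} [NeZero L] {M M' : Fin (d + 1) → ℕ} [∀ μ, NeZero (M μ)] [∀ μ, NeZero (M' μ)] {k r : ℕ}

/-- ★★ **THE UNCUT η-DEFECT OF THE CUBE PROPAGATOR ON ITS OWN TORUS, EXACTLY** (`M_ν = 2S`, spacings `L^k ⊂ L^r·L^k`, King's `P` on both sides):
`𝔇(G′(□ + c), G(□ + c)) = Sym′ ∘ 𝔇(G′, G) ∘ M_{χ_□} + (Σ_T M_{mask_T} ∘ P ∘ R_T ∘ D) ∘ (G ∘ M_{χ_□})` — `G(□) = Sym∘G∘M_{χ_□}` (N-IIb), Leibniz, `𝔇(χ′_□, χ_□) = 0`, the symmetriser's defect (N-IIa).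
[cite: Balaban1985BackgroundPropagators, Thm 3.14 pp.426–427 (difference template), (3.42) p.397 (shape); Balaban1984PropagatorsII, (2.37) p.229 (Neumann cubes by images); King1986, p.664] -/
theorem idef_neumannCubeG {c : Tor M} {S : ℕ} (hM2 : ∀ ν, M ν = 2 * S) {a : ℝ} (ha : 0 < a) :
    idef (pull (kingPrV L k r M)) (pull (kingPrV L k r M)) (neumannCubeG M (L ^ r * L ^ k) c S a) (neumannCubeG M (L ^ k) c S a) =
      symOp M (L ^ r * L ^ k) c ∘ₗ (idef (pull (kingPrV L k r M)) (pull (kingPrV L k r M)) (gOp M (L ^ r * L ^ k) a) (gOp M (L ^ k) a) ∘ₗ mulOp (chiCube M (L ^ k) c S)) +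
        (∑ T ∈ (Finset.univ : Finset (Fin (d + 1))).powerset,
            mulOp (faceMask M (L ^ r * L ^ k) (L ^ r) T) ∘ₗ pull (kingPrV L k r M) ∘ₗ reflSet M (L ^ k) c T ∘ₗ ownDiff M (L ^ k)) ∘ₗ
          (gOp M (L ^ k) a ∘ₗ mulOp (chiCube M (L ^ k) c S)) := by
  have hL0 : 0 < L := Nat.pos_of_ne_zero (NeZero.ne L)
  have hn : 1 ≤ L ^ k := Nat.one_le_pow _ _ hL0
  have hn' : 1 ≤ L ^ r * L ^ k := Nat.one_le_iff_ne_zero.mpr (Nat.mul_ne_zero (pow_ne_zero r (NeZero.ne L)) (by positivity))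
  rw [neumannCubeG_eq_chiCube M (L ^ r * L ^ k) c S a hM2 hn' ha, neumannCubeG_eq_chiCube M (L ^ k) c S a hM2 hn ha,
    idef_comp _ (pull (kingPrV L k r M)), idef_comp _ (pull (kingPrV L k r M)), idef_mulOp_chiCube, LinearMap.comp_zero, zero_add, idef_symOp_kingPrV]

variable (hM : ∀ μ, M' μ ∣ M μ) (c : Tor M) (S : ℕ)

/-- ★★ **THE η-DEFECT OF THE LIFTED CUBE PROPAGATOR BEHIND A BIG-TORUS OPERATOR, EXACTLY** (`M′_ν = 2S ∣ M_ν`; `T₁, T₁′` ANY operators of the big torus at the two spacings):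
`𝔇(χ′_□T₁′G′^{↑}(□), χ_□T₁G^{↑}(□)) = χ′_□ ∘ (T₁′ ∘ π′^* ∘ [Sym′∘𝔇̃(G′,G)∘χ_{□′} + (Σ_T M_{mask_T}∘P̃∘R_T∘D)∘(G∘χ_{□′})] ∘ ρ + 𝔇(T₁′, T₁) ∘ G^{↑}(□))` — Leibniz twice, `𝔇(χ′_□, χ_□) = 0`
(N-IIb `idef_mulOp_chiCube` on the big torus), §34 `idef_liftCubeG`, `idef_neumannCubeG` on the cube torus.  No letter is used.
[cite: Balaban1985BackgroundPropagators, Thm 3.14 pp.426–427 (difference template); Balaban1984PropagatorsII, (2.37) p.229, p.238 (T_□), (2.90)–(2.91) p.239; King1986, p.664] -/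
theorem idef_chiCube_comp_liftCubeG (hM2 : ∀ ν, M' ν = 2 * S) {a : ℝ} (ha : 0 < a) (T₁ : Module.End ℝ (Tor (fine (L ^ k) M) × Fin (d + 1) → ℝ))
    (T₁' : Module.End ℝ (Tor (fine (L ^ r * L ^ k) M) × Fin (d + 1) → ℝ)) :
    idef (pull (kingPrV L k r M)) (pull (kingPrV L k r M))
        (mulOp (chiCube M (L ^ r * L ^ k) c S) ∘ₗ T₁' ∘ₗ liftCubeG (L ^ r * L ^ k) hM c S a) (mulOp (chiCube M (L ^ k) c S) ∘ₗ T₁ ∘ₗ liftCubeG (L ^ k) hM c S a) =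
      mulOp (chiCube M (L ^ r * L ^ k) c S) ∘ₗ
        (T₁' ∘ₗ (pullVR (L ^ r * L ^ k) hM ∘ₗ
            (symOp M' (L ^ r * L ^ k) (torRed hM c) ∘ₗ (idef (pull (kingPrV L k r M')) (pull (kingPrV L k r M')) (gOp M' (L ^ r * L ^ k) a) (gOp M' (L ^ k) a) ∘ₗ
                mulOp (chiCube M' (L ^ k) (torRed hM c) S)) +
              (∑ T ∈ (Finset.univ : Finset (Fin (d + 1))).powerset,
                  mulOp (faceMask M' (L ^ r * L ^ k) (L ^ r) T) ∘ₗ pull (kingPrV L k r M') ∘ₗ reflSet M' (L ^ k) (torRed hM c) T ∘ₗ ownDiff M' (L ^ k)) ∘ₗ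
                (gOp M' (L ^ k) a ∘ₗ mulOp (chiCube M' (L ^ k) (torRed hM c) S))) ∘ₗ
            restrictOp (cubeW (L ^ k) c S) (redBond (L ^ k) hM)) +
          idef (pull (kingPrV L k r M)) (pull (kingPrV L k r M)) T₁' T₁ ∘ₗ liftCubeG (L ^ k) hM c S a) := by
  have hS : ∀ ν, S ≤ M' ν := fun ν => by rw [hM2 ν]; omega
  rw [idef_comp _ (pull (kingPrV L k r M)), idef_mulOp_chiCube, LinearMap.zero_comp, add_zero, idef_comp _ (pull (kingPrV L k r M)), idef_liftCubeG hM c S hS,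
    idef_neumannCubeG hM2 ha]

/-- ★★★ **THE η-DEFECT OF THE LIFTED CUBE PROPAGATOR BEHIND A BIG-TORUS OPERATOR THAT NEED NOT DESCEND — dag-n15-c WANT-n15-a (g12-3)** (torus pair `M′_ν = 2S ∣ M_ν`, cube `□ + c` of side `S`,
coarse `n = L^k`, fine `n′ = L^r·n`, King's prolongation `P` on the BIG torus both sides).  INPUT LETTERS — N-IIk's, the torus data now on the CUBE torus `M′` at the image corner `π̃c`: the coarse
propagator `G ≤ Ce^{−δ₀d′}` (`hG`), the two-grid defect `𝔇̃(G′, G) ≤ C₀e^{−δ₀d′}` (`h0`), the coarse gradients `∇_νG ≤ C₁e^{−δ₀d′}` (`h1`, `η⁻¹`-normalised); on the BIG torus: the FINE operator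
`T₁′ ≤ a₁e^{−ρ₁d}` (`hT′`) and the operators' defect `𝔇(T₁′, T₁) ≤ r₁e^{−ρ₁d}` (`hDT`); the big torus's row sum `c_r` at rate `σ`, `ρ ≤ δ₀`, `ρ + σ ≤ ρ₁`.  OUTPUT:
`𝔇(χ′_□∘T₁′∘G′^{↑}(□), χ_□∘T₁∘G^{↑}(□)) ≤ 1_□(y)1_□(y′)·2^{d+1}e^{δ₀}c_r·(a₁C₀ + a₁(d+1)C₁∕L^k + r₁C)·e^{−ρ|y−y′|_T}` — N-IIk's constant VERBATIM; linear in `C₀`, in one `η = L^{−k}` and in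
`r₁`; the coarse `T₁` enters only through `𝔇(T₁′, T₁)`; `T₁, T₁′` need NOT descend (e.g. `[aQ*Q − ∂Π∂*, M_{h_k}]` with an `M`-periodic `h_k`).
[cite: Balaban1985BackgroundPropagators, Thm 3.14 pp.426–427 (difference template), (3.42) p.397 (shape); Balaban1984PropagatorsII, (2.37) p.229 (images), Lemma 2.1 (2.61)–(2.62) p.234
(row sums), p.238 (T_□), (2.90)–(2.91) p.239, (2.133)–(2.134) p.247 (shapes); Balaban1984PropagatorsI, (1.126)–(1.128) p.38; King1986, p.664] -/
theorem hasMaj_idef_chiCube_comp_liftCubeG_of (hM2 : ∀ ν, M' ν = 2 * S) {a : ℝ} (ha : 0 < a) {C C₀ C₁ δ₀ a₁ r₁ ρ₁ ρ σ cr : ℝ}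
    (htri' : Triangle254 (unitTorusGeo L k M')) (hrow : RowSum (unitTorusGeo L k M) σ cr) (hC : 0 ≤ C) (hC₀ : 0 ≤ C₀) (hC₁ : 0 ≤ C₁) (hδ₀ : 0 ≤ δ₀) (ha₁ : 0 ≤ a₁) (hr₁ : 0 ≤ r₁)
    (hρ : 0 ≤ ρ) (hρδ : ρ ≤ δ₀) (hρσ : ρ + σ ≤ ρ₁)
    {T₁ : Module.End ℝ (Tor (fine (L ^ k) M) × Fin (d + 1) → ℝ)} {T₁' : Module.End ℝ (Tor (fine (L ^ r * L ^ k) M) × Fin (d + 1) → ℝ)}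
    (hG : HasMaj (BlockNorm.ofBlocks (unitTorusGeo L k M') (fun b : Tor (fine (L ^ k) M') × Fin (d + 1) => blockOf (L ^ k) M' b.1))
      (BlockNorm.ofBlocks (unitTorusGeo L k M') (fun b : Tor (fine (L ^ k) M') × Fin (d + 1) => blockOf (L ^ k) M' b.1)) (gOp M' (L ^ k) a)
      (fun y y' => C * Real.exp (-(δ₀ * tdistT M' y y'))))
    (h0 : HasMaj (BlockNorm.ofBlocks (unitTorusGeo L k M') (fun b : Tor (fine (L ^ k) M') × Fin (d + 1) => blockOf (L ^ k) M' b.1))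
      (BlockNorm.ofBlocks (unitTorusGeo L k M') (fun b' : Tor (fine (L ^ r * L ^ k) M') × Fin (d + 1) => blockOf (L ^ r * L ^ k) M' b'.1))
      (idef (pull (kingPrV L k r M')) (pull (kingPrV L k r M')) (gOp M' (L ^ r * L ^ k) a) (gOp M' (L ^ k) a)) (fun y y' => C₀ * Real.exp (-(δ₀ * tdistT M' y y'))))
    (h1 : ∀ ν, HasMaj (BlockNorm.ofBlocks (unitTorusGeo L k M') (fun b : Tor (fine (L ^ k) M') × Fin (d + 1) => blockOf (L ^ k) M' b.1))
      (BlockNorm.ofBlocks (unitTorusGeo L k M') (fun b : Tor (fine (L ^ k) M') × Fin (d + 1) => blockOf (L ^ k) M' b.1))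
      (symbOp M' (L ^ k) (sD M' (L ^ k) ν ((L ^ k : ℕ) : ℝ)) ∘ₗ gOp M' (L ^ k) a) (fun y y' => C₁ * Real.exp (-(δ₀ * tdistT M' y y'))))
    (hT' : HasMaj (BlockNorm.ofBlocks (unitTorusGeo L k M) (fun b' : Tor (fine (L ^ r * L ^ k) M) × Fin (d + 1) => blockOf (L ^ r * L ^ k) M b'.1))
      (BlockNorm.ofBlocks (unitTorusGeo L k M) (fun b' : Tor (fine (L ^ r * L ^ k) M) × Fin (d + 1) => blockOf (L ^ r * L ^ k) M b'.1)) T₁'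
      (fun y y' => a₁ * Real.exp (-(ρ₁ * tdistT M y y'))))
    (hDT : HasMaj (BlockNorm.ofBlocks (unitTorusGeo L k M) (fun b : Tor (fine (L ^ k) M) × Fin (d + 1) => blockOf (L ^ k) M b.1))
      (BlockNorm.ofBlocks (unitTorusGeo L k M) (fun b' : Tor (fine (L ^ r * L ^ k) M) × Fin (d + 1) => blockOf (L ^ r * L ^ k) M b'.1))
      (idef (pull (kingPrV L k r M)) (pull (kingPrV L k r M)) T₁' T₁) (fun y y' => r₁ * Real.exp (-(ρ₁ * tdistT M y y')))) :
    HasMaj (BlockNorm.ofBlocks (unitTorusGeo L k M) (fun b : Tor (fine (L ^ k) M) × Fin (d + 1) => blockOf (L ^ k) M b.1))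
      (BlockNorm.ofBlocks (unitTorusGeo L k M) (fun b' : Tor (fine (L ^ r * L ^ k) M) × Fin (d + 1) => blockOf (L ^ r * L ^ k) M b'.1))
      (idef (pull (kingPrV L k r M)) (pull (kingPrV L k r M))
        (mulOp (chiCube M (L ^ r * L ^ k) c S) ∘ₗ T₁' ∘ₗ liftCubeG (L ^ r * L ^ k) hM c S a) (mulOp (chiCube M (L ^ k) c S) ∘ₗ T₁ ∘ₗ liftCubeG (L ^ k) hM c S a))
      (fun y y' => ind (cubeBlocks M c S : Set (Tor M)) y * ind (cubeBlocks M c S : Set (Tor M)) y' *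
        ((2 ^ (d + 1) * Real.exp δ₀ * cr * (a₁ * C₀ + a₁ * ((d + 1) * (C₁ / (L ^ k : ℕ))) + r₁ * C)) * Real.exp (-(ρ * tdistT M y y')))) := by
  have hcr : 0 ≤ cr := hrow.nonneg c
  have hS : ∀ ν, S ≤ M' ν := fun ν => by rw [hM2 ν]; omega
  -- distribute the exact identity into the three terms
  have hid := idef_chiCube_comp_liftCubeG (k := k) (r := r) hM c S hM2 ha T₁ T₁'
  simp only [LinearMap.comp_add, LinearMap.add_comp, fsum_comp, comp_fsum] at hid
  rw [hid]
  -- a one-sided source indicator on the cube torus costs nothing after the transfer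
  have drop : ∀ {n₂ : ℕ} [NeZero n₂] {Y : (Tor (fine (L ^ k) M) × Fin (d + 1) → ℝ) →ₗ[ℝ] (Tor (fine n₂ M) × Fin (d + 1) → ℝ)} {K : Tor M → Tor M → ℝ}
      (_ : ∀ y y', 0 ≤ K y y'),
      HasMaj (BlockNorm.ofBlocks (unitTorusGeo L k M) (fun b : Tor (fine (L ^ k) M) × Fin (d + 1) => blockOf (L ^ k) M b.1))
        (BlockNorm.ofBlocks (unitTorusGeo L k M) (fun b : Tor (fine n₂ M) × Fin (d + 1) => blockOf n₂ M b.1)) Y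
        (fun y y' => ind (cubeBlocks M c S : Set (Tor M)) y' *
          (ind (g := unitTorusGeo L k M') (cubeBlocks M' (torRed hM c) S : Set (Tor M')) (torRed hM y') * K y y')) →
      HasMaj (BlockNorm.ofBlocks (unitTorusGeo L k M) (fun b : Tor (fine (L ^ k) M) × Fin (d + 1) => blockOf (L ^ k) M b.1))
        (BlockNorm.ofBlocks (unitTorusGeo L k M) (fun b : Tor (fine n₂ M) × Fin (d + 1) => blockOf n₂ M b.1)) Y
        (fun y y' => ind (cubeBlocks M c S : Set (Tor M)) y' * K y y') := by
    intro n₂ _ Y K hK h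
    refine h.mono fun y y' => mul_le_mul_of_nonneg_left ?_ (ind_nonneg _ _)
    calc ind (g := unitTorusGeo L k M') (cubeBlocks M' (torRed hM c) S : Set (Tor M')) (torRed hM y') * K y y' ≤ 1 * K y y' :=
          mul_le_mul_of_nonneg_right (ind_le_one _ _) (hK y y')
      _ = K y y' := one_mul _
  -- TERM A1: the cube torus's two-grid defect, source-cut, symmetrised; lifted uncut; behind `T₁′`; output-cut
  have hX0 := hasMaj_comp_mulOp_chiCube (c := torRed hM c) (S := S) (fun y y' => mul_nonneg hC₀ (Real.exp_nonneg _)) h0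
  have hY1 := hasMaj_symOp_comp_images (c := torRed hM c) (fun _ => ind_nonneg _ _) hC₀ hδ₀ hX0
  have hL1 := drop (fun y y' => mul_nonneg (by positivity) (Finset.sum_nonneg fun _ _ => Real.exp_nonneg _))
    (hasMaj_pullVR_comp_restrict (k := k) hM c S hS (L ^ k) (L ^ r * L ^ k)
      (fun z z' => mul_nonneg (ind_nonneg _ _) (mul_nonneg (by positivity) (Finset.sum_nonneg fun _ _ => Real.exp_nonneg _))) hY1)
  have hA1c := hasMaj_comp_of_liftImages (L ^ r * L ^ k) hM c htri' hrow (fun _ => ind_nonneg _ _) (by positivity : (0 : ℝ) ≤ C₀ * Real.exp δ₀) ha₁ hρ hρδ hρσ hT' hL1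
  have hA1 := hasMaj_chiCube_comp_of_liftImages (L ^ r * L ^ k) hM c S hM2 (by positivity : (0 : ℝ) ≤ a₁ * (C₀ * Real.exp δ₀) * cr) hρ hA1c
  -- TERM A2: the `2^{d+1}` face terms: one own-direction coarse difference of `G`, source-cut, reflected, paired, masked (cube torus); lifted uncut; behind `T₁′`; output-cut
  have hblk : ∀ x : Tor (fine (L ^ r * L ^ k) M') × Fin (d + 1), blockOf (L ^ k) M' (kingPrV L k r M' x).1 = blockOf (L ^ r * L ^ k) M' x.1 := fun x =>
    congrFun (blkFine_comp_kingPrV M' L k r) x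
  have hD := hasMaj_ownDiff_comp hC₁ h1
  have hX : HasMaj (BlockNorm.ofBlocks (unitTorusGeo L k M') (fun b : Tor (fine (L ^ k) M') × Fin (d + 1) => blockOf (L ^ k) M' b.1))
      (BlockNorm.ofBlocks (unitTorusGeo L k M') (fun b : Tor (fine (L ^ k) M') × Fin (d + 1) => blockOf (L ^ k) M' b.1))
      (ownDiff M' (L ^ k) ∘ₗ gOp M' (L ^ k) a ∘ₗ mulOp (chiCube M' (L ^ k) (torRed hM c) S))
      (fun y y' => ind (g := unitTorusGeo L k M') (cubeBlocks M' (torRed hM c) S : Set (Tor M')) y' * ((d + 1) * (C₁ / (L ^ k : ℕ)) * Real.exp (-(δ₀ * tdistT M' y y')))) :=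
    (hasMaj_comp_mulOp_chiCube (c := torRed hM c) (S := S) (fun y y' => by positivity) hD).congr fun μ => rfl
  have hA2 : ∀ T : Finset (Fin (d + 1)),
      HasMaj (BlockNorm.ofBlocks (unitTorusGeo L k M) (fun b : Tor (fine (L ^ k) M) × Fin (d + 1) => blockOf (L ^ k) M b.1))
        (BlockNorm.ofBlocks (unitTorusGeo L k M) (fun b' : Tor (fine (L ^ r * L ^ k) M) × Fin (d + 1) => blockOf (L ^ r * L ^ k) M b'.1))
        (mulOp (chiCube M (L ^ r * L ^ k) c S) ∘ₗ (T₁' ∘ₗ (pullVR (L ^ r * L ^ k) hM ∘ₗ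
          (((mulOp (faceMask M' (L ^ r * L ^ k) (L ^ r) T) ∘ₗ pull (kingPrV L k r M') ∘ₗ reflSet M' (L ^ k) (torRed hM c) T ∘ₗ ownDiff M' (L ^ k)) ∘ₗ
            (gOp M' (L ^ k) a ∘ₗ mulOp (chiCube M' (L ^ k) (torRed hM c) S))) ∘ₗ restrictOp (cubeW (L ^ k) c S) (redBond (L ^ k) hM)))))
        (fun y y' => ind (cubeBlocks M c S : Set (Tor M)) y * ind (cubeBlocks M c S : Set (Tor M)) y' *
          (a₁ * ((d + 1) * (C₁ / (L ^ k : ℕ)) * Real.exp δ₀) * cr * Real.exp (-(ρ * tdistT M y y')))) := by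
    intro T
    have hc₁ : (0 : ℝ) ≤ (d + 1) * (C₁ / (L ^ k : ℕ)) := by positivity
    have hK0 : ∀ y y' : Tor M', 0 ≤ ind (g := unitTorusGeo L k M') (cubeBlocks M' (torRed hM c) S : Set (Tor M')) y' *
        ((d + 1) * (C₁ / (L ^ k : ℕ)) * Real.exp δ₀ * Real.exp (-(δ₀ * tdistT M' (reflBlk M' (torRed hM c) T y) y'))) := fun y y' => mul_nonneg (ind_nonneg _ _) (by positivity)
    -- on the cube torus: reflect, pair (blocks are preserved), mask (`|mask| ≤ 1`)
    have hR := hasMaj_reflSet_comp_images (c := torRed hM c) (fun _ => ind_nonneg _ _) hc₁ hδ₀ T hX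
    have hP := hasMaj_pull_comp₂ (g := unitTorusGeo L k M') (fun b : Tor (fine (L ^ k) M') × Fin (d + 1) => blockOf (L ^ k) M' b.1)
      (fun b' : Tor (fine (L ^ r * L ^ k) M') × Fin (d + 1) => blockOf (L ^ r * L ^ k) M' b'.1) (kingPrV L k r M') hK0 (fun x y' => by rw [hblk x]) hR
    have hZ := hasMaj_mulOp_comp_of_abs_le_one _ (abs_faceMask_le_one (M := M') (n := L ^ r * L ^ k) (L ^ r) T) hK0 hP
    -- lift uncut, drop the cube torus's source indicator, convolve with `T₁′` on the big torus, cut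
    have hZl := drop (fun y y' => by positivity)
      ((hasMaj_pullVR_comp_restrict (k := k) hM c S hS (L ^ k) (L ^ r * L ^ k) hK0 hZ).congr fun μ => rfl)
    have hW := hasMaj_comp_of_liftImage (L ^ r * L ^ k) hM c htri' hrow (fun _ => ind_nonneg _ _) (by positivity : (0 : ℝ) ≤ (d + 1) * (C₁ / (L ^ k : ℕ)) * Real.exp δ₀)
      ha₁ hρ hρδ hρσ T hT' hZl
    exact (hasMaj_chiCube_comp_of_liftImage (L ^ r * L ^ k) hM c S hM2 (by positivity) hρ T hW).congr fun μ => rfl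
  have hA2s := hasMaj_finsum (Finset.univ : Finset (Fin (d + 1))).powerset _ _ fun T _ => hA2 T
  -- TERM B: the operators' defect behind the uncut lifted cube propagator (P-IIe images letter), output-cut
  have hN := hasMaj_liftCubeG_images (L ^ k) hM c S hM2 hC hδ₀ hG
  have hBc := hasMaj_comp_of_liftImages (L ^ k) hM c htri' hrow (fun _ => ind_nonneg _ _) (by positivity : (0 : ℝ) ≤ C * Real.exp δ₀) hr₁ hρ hρδ hρσ hDT hN
  have hB := hasMaj_chiCube_comp_of_liftImages (L ^ r * L ^ k) hM c S hM2 (by positivity : (0 : ℝ) ≤ r₁ * (C * Real.exp δ₀) * cr) hρ hBc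
  refine ((hA1.add hA2s).add hB).mono fun y y' => le_of_eq ?_
  rw [Finset.sum_const, Finset.card_powerset, Finset.card_univ, Fintype.card_fin, nsmul_eq_mul]
  push_cast
  ring

end Row

/-! ## §36 The row on the torus family of record: cube side `L^s` FIXED, volume `2L^{m_T}` FREE — constants UNIFORM in the volume -/

section Family

variable {L : ℕ} [NeZero L]

/-- ★★★ **WANT-n15-a (g12-3) ON THE TORUS FAMILY OF RECORD, CUBE-TORUS LETTERS AS HYPOTHESES**: on `M = MP (paramsOf d L m_T k hL)` (`M_ν = 2L^{m_T}`) with cube torus `M′ = MP (paramsOf d L s k hL)`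
(`M′_ν = 2L^s`), `s ≤ m_T`, any corner `c`, spacings `L^k ⊂ L^r·L^k`: from the cube torus's `G ≤ Ce^{−δ₀d′}`, `𝔇̃(G′,G) ≤ C₀e^{−δ₀d′}`, `∇_νG ≤ C₁e^{−δ₀d′}` and the big torus's `T₁′ ≤ a₁e^{−ρ₁d}`,
`𝔇(T₁′,T₁) ≤ r₁e^{−ρ₁d}`, row sum `c_r` at `σ` (`ρ ≤ δ₀`, `ρ + σ ≤ ρ₁`):
`𝔇(χ′_□T₁′G′^{↑}(□ + c), χ_□T₁G^{↑}(□ + c)) ≤ 1_□(y)1_□(y′)·2^{d+1}e^{δ₀}c_r·(a₁C₀ + a₁(d+1)C₁∕L^k + r₁C)·e^{−ρ|y−y′|_T}` — the SAME constant for every volume `m_T ≥ s`.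
[cite: Balaban1985BackgroundPropagators, Thm 3.14 pp.426–427 (difference template), (3.42) p.397 (shape); Balaban1984PropagatorsII, (2.37) p.229, Lemma 2.1 (2.61)–(2.62) p.234, p.238 (T_□),
(2.90)–(2.91) p.239, (2.133)–(2.134) p.247; King1986, p.664] -/
theorem hasMaj_idef_chiCube_comp_liftCubeG_family (hL : Odd L ∧ 1 < L) {s mT k r : ℕ} (hs : s ≤ mT) (c : Tor (MP (paramsOf d L mT k hL))) {a : ℝ} (ha : 0 < a)
    {C C₀ C₁ δ₀ a₁ r₁ ρ₁ ρ σ cr : ℝ} (hrow : RowSum (unitTorusGeo L k (MP (paramsOf d L mT k hL))) σ cr) (hC : 0 ≤ C) (hC₀ : 0 ≤ C₀) (hC₁ : 0 ≤ C₁) (hδ₀ : 0 ≤ δ₀) (ha₁ : 0 ≤ a₁)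
    (hr₁ : 0 ≤ r₁) (hρ : 0 ≤ ρ) (hρδ : ρ ≤ δ₀) (hρσ : ρ + σ ≤ ρ₁)
    {T₁ : Module.End ℝ (Tor (fine (L ^ k) (MP (paramsOf d L mT k hL))) × Fin (d + 1) → ℝ)}
    {T₁' : Module.End ℝ (Tor (fine (L ^ r * L ^ k) (MP (paramsOf d L mT k hL))) × Fin (d + 1) → ℝ)}
    (hG : HasMaj (BlockNorm.ofBlocks (unitTorusGeo L k (MP (paramsOf d L s k hL))) (blkFine L k (MP (paramsOf d L s k hL))))
      (BlockNorm.ofBlocks (unitTorusGeo L k (MP (paramsOf d L s k hL))) (blkFine L k (MP (paramsOf d L s k hL)))) (gOp (MP (paramsOf d L s k hL)) (L ^ k) a)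
      (fun y y' => C * Real.exp (-(δ₀ * tdistT (MP (paramsOf d L s k hL)) y y'))))
    (h0 : HasMaj (BlockNorm.ofBlocks (unitTorusGeo L k (MP (paramsOf d L s k hL))) (blkFine L k (MP (paramsOf d L s k hL))))
      (BlockNorm.ofBlocks (unitTorusGeo L k (MP (paramsOf d L s k hL)))
        (fun i : Tor (fine (L ^ r * L ^ k) (MP (paramsOf d L s k hL))) × Fin (d + 1) => blockOf (L ^ r * L ^ k) (MP (paramsOf d L s k hL)) i.1))
      (idef (pull (kingPrV L k r (MP (paramsOf d L s k hL)))) (pull (kingPrV L k r (MP (paramsOf d L s k hL))))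
        (gOp (MP (paramsOf d L s k hL)) (L ^ r * L ^ k) a) (gOp (MP (paramsOf d L s k hL)) (L ^ k) a))
      (fun y y' => C₀ * Real.exp (-(δ₀ * tdistT (MP (paramsOf d L s k hL)) y y'))))
    (h1 : ∀ ν, HasMaj (BlockNorm.ofBlocks (unitTorusGeo L k (MP (paramsOf d L s k hL))) (blkFine L k (MP (paramsOf d L s k hL))))
      (BlockNorm.ofBlocks (unitTorusGeo L k (MP (paramsOf d L s k hL))) (blkFine L k (MP (paramsOf d L s k hL))))
      (symbOp (MP (paramsOf d L s k hL)) (L ^ k) (sD (MP (paramsOf d L s k hL)) (L ^ k) ν ((L ^ k : ℕ) : ℝ)) ∘ₗ gOp (MP (paramsOf d L s k hL)) (L ^ k) a)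
      (fun y y' => C₁ * Real.exp (-(δ₀ * tdistT (MP (paramsOf d L s k hL)) y y'))))
    (hT' : HasMaj (BlockNorm.ofBlocks (unitTorusGeo L k (MP (paramsOf d L mT k hL)))
        (fun i : Tor (fine (L ^ r * L ^ k) (MP (paramsOf d L mT k hL))) × Fin (d + 1) => blockOf (L ^ r * L ^ k) (MP (paramsOf d L mT k hL)) i.1))
      (BlockNorm.ofBlocks (unitTorusGeo L k (MP (paramsOf d L mT k hL)))
        (fun i : Tor (fine (L ^ r * L ^ k) (MP (paramsOf d L mT k hL))) × Fin (d + 1) => blockOf (L ^ r * L ^ k) (MP (paramsOf d L mT k hL)) i.1)) T₁'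
      (fun y y' => a₁ * Real.exp (-(ρ₁ * tdistT (MP (paramsOf d L mT k hL)) y y'))))
    (hDT : HasMaj (BlockNorm.ofBlocks (unitTorusGeo L k (MP (paramsOf d L mT k hL))) (blkFine L k (MP (paramsOf d L mT k hL))))
      (BlockNorm.ofBlocks (unitTorusGeo L k (MP (paramsOf d L mT k hL)))
        (fun i : Tor (fine (L ^ r * L ^ k) (MP (paramsOf d L mT k hL))) × Fin (d + 1) => blockOf (L ^ r * L ^ k) (MP (paramsOf d L mT k hL)) i.1))
      (idef (pull (kingPrV L k r (MP (paramsOf d L mT k hL)))) (pull (kingPrV L k r (MP (paramsOf d L mT k hL)))) T₁' T₁)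
      (fun y y' => r₁ * Real.exp (-(ρ₁ * tdistT (MP (paramsOf d L mT k hL)) y y')))) :
    HasMaj (BlockNorm.ofBlocks (unitTorusGeo L k (MP (paramsOf d L mT k hL))) (blkFine L k (MP (paramsOf d L mT k hL))))
      (BlockNorm.ofBlocks (unitTorusGeo L k (MP (paramsOf d L mT k hL)))
        (fun i : Tor (fine (L ^ r * L ^ k) (MP (paramsOf d L mT k hL))) × Fin (d + 1) => blockOf (L ^ r * L ^ k) (MP (paramsOf d L mT k hL)) i.1))
      (idef (pull (kingPrV L k r (MP (paramsOf d L mT k hL)))) (pull (kingPrV L k r (MP (paramsOf d L mT k hL))))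
        (mulOp (chiCube (MP (paramsOf d L mT k hL)) (L ^ r * L ^ k) c (L ^ s)) ∘ₗ T₁' ∘ₗ liftCubeG (L ^ r * L ^ k) (MP_dvd_MP hL hs k) c (L ^ s) a)
        (mulOp (chiCube (MP (paramsOf d L mT k hL)) (L ^ k) c (L ^ s)) ∘ₗ T₁ ∘ₗ liftCubeG (L ^ k) (MP_dvd_MP hL hs k) c (L ^ s) a))
      (fun y y' => ind ((cubeBlocks (MP (paramsOf d L mT k hL)) c (L ^ s) : Finset _) : Set _) y *
        ind ((cubeBlocks (MP (paramsOf d L mT k hL)) c (L ^ s) : Finset _) : Set _) y' *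
        ((2 ^ (d + 1) * Real.exp δ₀ * cr * (a₁ * C₀ + a₁ * ((d + 1) * (C₁ / (L ^ k : ℕ))) + r₁ * C)) * Real.exp (-(ρ * tdistT (MP (paramsOf d L mT k hL)) y y')))) :=
  hasMaj_idef_chiCube_comp_liftCubeG_of (MP_dvd_MP hL hs k) c (L ^ s) (fun _ => rfl) ha (B6UnitTorusCarrier.triangle254_unitTorusGeo L k _) hrow hC hC₀ hC₁ hδ₀ ha₁ hr₁ hρ hρδ
    hρσ hG h0 h1 hT' hDT

/-- ★★★ **WANT-n15-a (g12-3) ON THE TORUS FAMILY OF RECORD WITH PROGRAMME N's CONSTANTS**: for odd `L ≥ 3`, `a > 0`, `0 < γ < 1` there are `δ₀, C, C₀, C₁ > 0` (part 39 `hasMaj_gOp` ∕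
`hasMaj_entries110` = [B5] Prop. 1.2 (1.110) on the tori `2L^s`; part 52ff `hasMaj_twoGridDefect` = King's two-grid rate `(L^k)^{−γ∕2}`) such that for EVERY cube exponent `s`, volume `m_T ≥ s`,
coarse level `k ≥ 1`, refinement `r`, corner `c`, ANY big-torus operators `T₁, T₁′` with `T₁′ ≤ a₁e^{−ρ₁d}`, `𝔇(T₁′,T₁) ≤ r₁e^{−ρ₁d}` and any row sum `c_r` of the big torus at `σ`
(`ρ ≤ δ₀`, `ρ + σ ≤ ρ₁`): `𝔇(χ′_□T₁′G′^{↑}(□ + c), χ_□T₁G^{↑}(□ + c)) ≤ 1_□(y)1_□(y′)·2^{d+1}e^{δ₀}c_r·(a₁C₀(L^k)^{−γ∕2} + a₁(d+1)C₁∕L^k + r₁C)·e^{−ρ|y−y′|_T}` — UNIFORM in `m_T`.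
[cite: Balaban1985BackgroundPropagators, Thm 3.14 pp.426–427, (3.42) p.397; Balaban1984PropagatorsII, (2.37) p.229, Lemma 2.1 (2.61)–(2.62) p.234, p.238 (T_□), (2.133)–(2.134) p.247;
Balaban1984PropagatorsI, Prop. 1.2 (1.110) p.35, (1.126)–(1.128) p.38; King1986, Prop. 3.8 (3.71) p.664] -/
theorem hasMaj_idef_chiCube_comp_liftCubeG_record (hLodd : Odd L) (hL2 : 2 ≤ L) {a : ℝ} (ha : 0 < a) {γ : ℝ} (hγ0 : 0 < γ) (hγ1 : γ < 1) :
    ∃ δ₀ C C₀ C₁ : ℝ, 0 < δ₀ ∧ 0 < C ∧ 0 < C₀ ∧ 0 < C₁ ∧ ∀ (s mT k r : ℕ) (hk : 1 ≤ k) (hL : Odd L ∧ 1 < L) (hs : s ≤ mT) (c : Tor (MP (paramsOf d L mT k hL)))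
      (T₁ : Module.End ℝ (Tor (fine (L ^ k) (MP (paramsOf d L mT k hL))) × Fin (d + 1) → ℝ))
      (T₁' : Module.End ℝ (Tor (fine (L ^ r * L ^ k) (MP (paramsOf d L mT k hL))) × Fin (d + 1) → ℝ)) {a₁ r₁ ρ₁ ρ σ cr : ℝ}
      (_hrow : RowSum (unitTorusGeo L k (MP (paramsOf d L mT k hL))) σ cr) (_ha₁ : 0 ≤ a₁) (_hr₁ : 0 ≤ r₁) (_hρ : 0 ≤ ρ) (_hρδ : ρ ≤ δ₀) (_hρσ : ρ + σ ≤ ρ₁)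
      (_hT' : HasMaj (BlockNorm.ofBlocks (unitTorusGeo L k (MP (paramsOf d L mT k hL)))
          (fun i : Tor (fine (L ^ r * L ^ k) (MP (paramsOf d L mT k hL))) × Fin (d + 1) => blockOf (L ^ r * L ^ k) (MP (paramsOf d L mT k hL)) i.1))
        (BlockNorm.ofBlocks (unitTorusGeo L k (MP (paramsOf d L mT k hL)))
          (fun i : Tor (fine (L ^ r * L ^ k) (MP (paramsOf d L mT k hL))) × Fin (d + 1) => blockOf (L ^ r * L ^ k) (MP (paramsOf d L mT k hL)) i.1)) T₁'
        (fun y y' => a₁ * Real.exp (-(ρ₁ * tdistT (MP (paramsOf d L mT k hL)) y y'))))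
      (_hDT : HasMaj (BlockNorm.ofBlocks (unitTorusGeo L k (MP (paramsOf d L mT k hL))) (blkFine L k (MP (paramsOf d L mT k hL))))
        (BlockNorm.ofBlocks (unitTorusGeo L k (MP (paramsOf d L mT k hL)))
          (fun i : Tor (fine (L ^ r * L ^ k) (MP (paramsOf d L mT k hL))) × Fin (d + 1) => blockOf (L ^ r * L ^ k) (MP (paramsOf d L mT k hL)) i.1))
        (idef (pull (kingPrV L k r (MP (paramsOf d L mT k hL)))) (pull (kingPrV L k r (MP (paramsOf d L mT k hL)))) T₁' T₁)
        (fun y y' => r₁ * Real.exp (-(ρ₁ * tdistT (MP (paramsOf d L mT k hL)) y y')))),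
      HasMaj (BlockNorm.ofBlocks (unitTorusGeo L k (MP (paramsOf d L mT k hL))) (blkFine L k (MP (paramsOf d L mT k hL))))
        (BlockNorm.ofBlocks (unitTorusGeo L k (MP (paramsOf d L mT k hL)))
          (fun i : Tor (fine (L ^ r * L ^ k) (MP (paramsOf d L mT k hL))) × Fin (d + 1) => blockOf (L ^ r * L ^ k) (MP (paramsOf d L mT k hL)) i.1))
        (idef (pull (kingPrV L k r (MP (paramsOf d L mT k hL)))) (pull (kingPrV L k r (MP (paramsOf d L mT k hL))))
          (mulOp (chiCube (MP (paramsOf d L mT k hL)) (L ^ r * L ^ k) c (L ^ s)) ∘ₗ T₁' ∘ₗ liftCubeG (L ^ r * L ^ k) (MP_dvd_MP hL hs k) c (L ^ s) a)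
          (mulOp (chiCube (MP (paramsOf d L mT k hL)) (L ^ k) c (L ^ s)) ∘ₗ T₁ ∘ₗ liftCubeG (L ^ k) (MP_dvd_MP hL hs k) c (L ^ s) a))
        (fun y y' => ind ((cubeBlocks (MP (paramsOf d L mT k hL)) c (L ^ s) : Finset _) : Set _) y *
          ind ((cubeBlocks (MP (paramsOf d L mT k hL)) c (L ^ s) : Finset _) : Set _) y' *
          ((2 ^ (d + 1) * Real.exp δ₀ * cr * (a₁ * (C₀ * ((L ^ k : ℕ) : ℝ) ^ (-(γ / 2))) + a₁ * ((d + 1) * (C₁ / (L ^ k : ℕ))) + r₁ * C)) *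
            Real.exp (-(ρ * tdistT (MP (paramsOf d L mT k hL)) y y')))) := by
  have hL : Odd L ∧ 1 < L := ⟨hLodd, by omega⟩
  obtain ⟨δG, C, hδG, hC, HG⟩ := hasMaj_gOp (d := d) hL ha
  obtain ⟨δD, C₀, hδD, hC₀, H0⟩ := hasMaj_twoGridDefect (d := d) hLodd hL2 ha hγ0 hγ1
  obtain ⟨δ₁, C₁, hδ₁, hC₁, H1⟩ := hasMaj_entries110 (d := d) hL ha
  refine ⟨min δG (min δD δ₁), C, C₀, C₁, lt_min hδG (lt_min hδD hδ₁), hC, hC₀, hC₁,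
    fun s mT k r hk hL' hs c T₁ T₁' a₁ r₁ ρ₁ ρ σ cr hrow ha₁ hr₁ hρ hρδ hρσ hT' hDT => ?_⟩
  have hρk : 0 ≤ C₀ * ((L ^ k : ℕ) : ℝ) ^ (-(γ / 2)) := mul_nonneg hC₀.le (Real.rpow_nonneg (Nat.cast_nonneg _) _)
  -- the three cube-torus letters at this index (`m := s`), decay weakened to the common rate
  have hG := hasMaj_rate_mono hC.le (min_le_left δG (min δD δ₁)) (HG s k hk)
  have h0 := hasMaj_rate_mono hρk ((min_le_right δG (min δD δ₁)).trans (min_le_left δD δ₁)) (H0 s k r hk hL')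
  have h1 := fun ν => hasMaj_rate_mono hC₁.le ((min_le_right δG (min δD δ₁)).trans (min_le_right δD δ₁)) (H1 s k hk ν).1
  exact hasMaj_idef_chiCube_comp_liftCubeG_family hL' hs c ha hrow hC.le hρk hC₁.le (lt_min hδG (lt_min hδD hδ₁)).le ha₁ hr₁ hρ hρδ hρσ hG h0 h1 hT' hDT

end Family

end Summit.QuantumFields.YangMills.BalabanUVNodes.N15.TwoGrid
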